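import Summits.BirchSwinnertonDyer.BirchSwinnertonDyer.Theorems.GenusKolyvaginAtTwoVisiblePairAtTwoCyclicPairing
import Literature.NumberTheory.EllipticCurves.CasselsTateLocalTerms
import Literature.NumberTheory.EllipticCurves.LocalWeilPairingDuality
import Literature.NumberTheory.EllipticCurves.HeegnerPointsKolyvaginPrimaryEigenProofs
import HarnessLib

/-!
# Route `GenusKolyvaginAtTwo`, crux `KolyvaginExactAtTwo` (22137) → Q3-inner: NON-VANISHING of the local
# term of the Cassels–Tate pairing from the orders of the two classes (McCallum's Lemma 5.3, local half)

Seat `bsd-line-gk2-p2` g12 (cell `bsd-f1-sign2`). THEOREMS ONLY (no definition, no named fact, no `sorry`).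

The displayed hypotheses `hloc₁`/`hloc₂` of this lineage's capstone
`selmer_eq_and_card_selmer_twin_eq_of_localTerms` (file `…CasselsTateLocalTerms`) ask that the local term
`t_v = inv_v((res_v b₁ − β_v) ∪ β'_v)` of the first case of the Cassels–Tate pairing (Milne, *ADT* I, proof of
Prop. 6.9; tree `ctLocalTerm`, `FirstCaseData.localTerm`) be NON-ZERO at the place of the new Kolyvagin prime.
McCallum (Lemma 5.3, proof of Thm. 5.4) gets this from "the Tate pairing induces a duality of cyclic groups
of order `p^M` … and the orders multiply to more than `p^M`". This file proves the generic local statement: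

* §1 `inv_weilLocalCup_ne_zero_of_orders` — over a non-archimedean local `K`-field `F` of characteristic `0`,
  level `m² = p^n`, with `#H¹(F, E)[m²] = p^n` and `#H¹(F, E)[p] = p` (so `H¹(F, E)[m²]` is CYCLIC, hence so
  is `H¹(F, E[m²])/𝓛_F ↪ H¹(F, E)[m²]`, `𝓛_F = ker(H¹(F, E[m²]) → H¹(F, E))`): for an injective `inv` on
  `H²(F, μ_{m²})`, `p^a x ∉ 𝓛_F`, `y ∈ 𝓛_F` with `p^b y ≠ 0` and `n ≤ a + b + 1` give **`inv(x ∪ y) ≠ 0`** —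
  the algebra is this lineage's `pairing_ne_zero_of_isAddCyclic_left` on the pairing descended to
  `H¹(F, E[m²])/𝓛_F × 𝓛_F` (isotropy of `𝓛_F`: the tree's discharged Poonen–Rains fact), the witness
  `∃ x₀, x₀ ∪ p^b y ≠ 0` being Tate local duality for `E[m²]` (`eq_zero_of_forall_weilCupProduct_eq_zero_right`);
  NO maximality `𝓛_F^⊥ = 𝓛_F` is needed;
* §1 `ctLocalTerm_ne_zero_of_orders` — the same for `t_F(b₁; β, β') = inv((res b₁ − β) ∪ β')` with
  `β, β' ∈ 𝓛_F` (`ctLocalTerm_congr_mid`: `β` may be replaced by `0`).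

BSD is not proved by any of this.

References: [McCallumLMS1991] §5 Lemma 5.3 and proof of Thm. 5.4; [MilneADT2006] I Cor. 2.3, Cor. 3.4,
Lemma 6.15, proof of Prop. 6.9; [PoonenRains2012] Prop. 4.10.
-/

set_option linter.dupNamespace false -- tree convention: `Summit.BirchSwinnertonDyer.BirchSwinnertonDyer.Theorems` (summit = sub-problem)
set_option autoImplicit false

noncomputable section

open scoped Classical

universe u

namespace Summit.BirchSwinnertonDyer.BirchSwinnertonDyer.Theorems.GenusExact.VisiblePairAtTwo

open WeierstrassCurve Field Function
open Literature.NumberTheory.EllipticCurves Literature.NumberTheory.GaloisRepresentations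
open Literature.NumberTheory.GaloisRepresentations.DiscreteGaloisModule (mu)
open scoped ContRepresentation

/-! ## §1. Non-vanishing of `inv(x ∪ y)` from the orders of `x mod 𝓛` and `y ∈ 𝓛` -/

section Generic

variable {K : Type u} [Field K] [CharZero K] (W : WeierstrassCurve K) [W.IsElliptic] (m : ℕ) [NeZero m]
variable (F : Type u) [Field F] [Algebra K F] [CharZero F]
  [ValuativeRel F] [TopologicalSpace F] [IsNonarchimedeanLocalField F]
variable (e : geomTorsion W ((m * m : ℕ) : ℤ) → geomTorsion W ((m * m : ℕ) : ℤ) → AlgebraicClosure K)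
  (hμ : ∀ S T, e S T ^ (m * m) = 1)
  (hadd₁ : ∀ S₁ S₂ T, e (S₁ + S₂) T = e S₁ T * e S₂ T)
  (hadd₂ : ∀ S T₁ T₂, e S (T₁ + T₂) = e S T₁ * e S T₂)
  (hgal : ∀ (σ : absoluteGaloisGroup K) (S T : geomTorsion W ((m * m : ℕ) : ℤ)),
    σ • e S T = e (σ • S) (σ • T))

omit [CharZero K] [W.IsElliptic] [NeZero m] [CharZero F] [ValuativeRel F] [TopologicalSpace F]
  [IsNonarchimedeanLocalField F] in
/-- **`H¹(F, E)[m²]` is cyclic** when `#H¹(F, E)[m²] = p^n` (`m² = p^n`) and `#H¹(F, E)[p] = p`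
(a finite abelian `p`-group with `p`-torsion of order `≤ p`; this lineage's
`KolyvaginEigenPow.isAddCyclic_of_card_torsion_le`). At a Kolyvagin prime both counts are Tate local
duality off `2` (`…LocalDualityOrder.natCard_torsionBy_localH1_two_pow_eq`). [cite: McCallumLMS1991, §5 Lemma 5.3] -/
theorem isAddCyclic_torsionBy_localH1 {p n : ℕ} (hp : p.Prime) (hmn : m * m = p ^ n)
    (hT : Nat.card (AddSubgroup.torsionBy (galoisCohomology (W.localGaloisModule F) 1)
      ((m * m : ℕ) : ℤ)) = p ^ n)
    (hT₁ : Nat.card (AddSubgroup.torsionBy (galoisCohomology (W.localGaloisModule F) 1) (p : ℤ)) = p) :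
    IsAddCyclic (AddSubgroup.torsionBy (galoisCohomology (W.localGaloisModule F) 1) ((m * m : ℕ) : ℤ)) := by
  set T := AddSubgroup.torsionBy (galoisCohomology (W.localGaloisModule F) 1) ((m * m : ℕ) : ℤ) with hTdef
  set T₁ := AddSubgroup.torsionBy (galoisCohomology (W.localGaloisModule F) 1) (p : ℤ) with hT₁def
  haveI : Finite T := Nat.finite_of_card_ne_zero (by rw [hT]; exact pow_ne_zero n hp.ne_zero)
  haveI : Finite T₁ := Nat.finite_of_card_ne_zero (by rw [hT₁]; exact hp.ne_zero)
  refine KolyvaginEigenPow.isAddCyclic_of_card_torsion_le (M := n) hp (fun g => ?_) ?_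
  · apply Subtype.ext
    rw [AddSubgroupClass.coe_nsmul, ← hmn, ZeroMemClass.coe_zero]
    exact AddSubgroup.torsionBy.nsmul_iff.mp g.2
  · -- `{g ∈ T | p g = 0} ↪ H¹(F, E)[p]`
    let f : {g : T // p • g = 0} → T₁ := fun g => ⟨(g.1 : galoisCohomology (W.localGaloisModule F) 1),
      AddSubgroup.torsionBy.nsmul_iff.mpr (by
        have h := congrArg (fun z : T => (z : galoisCohomology (W.localGaloisModule F) 1)) g.2
        simpa only [AddSubgroupClass.coe_nsmul, ZeroMemClass.coe_zero] using h)⟩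
    have hf : Injective f := by
      intro g g' h
      exact Subtype.ext (Subtype.ext (congrArg (fun z : T₁ => (z : galoisCohomology (W.localGaloisModule F) 1)) h))
    calc Nat.card {g : T // p • g = 0} ≤ Nat.card T₁ := Nat.card_le_card_of_injective f hf
      _ = p := hT₁
      _ ≤ p := le_rfl

/-- **Non-vanishing of `inv(x ∪ y)` from the orders** (McCallum's Lemma 5.3, local half, over a
non-archimedean local `K`-field `F` of characteristic `0`, level `m² = p^n`). Hypotheses: `e` a Weil pairing on
`E[m²]` (alternating, non-degenerate, Galois-equivariant); `#H¹(F, E)[m²] = p^n` and `#H¹(F, E)[p] = p`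
(Milne I Thm. 3.2 off `p`; then `H¹(F, E[m²])/𝓛_F ↪ H¹(F, E)[m²]` is cyclic of order `p^{n'} ≤ p^n`); `inv`
injective on `H²(F, μ_{m²})`, `p^n C = 0`. If `p^a x ∉ 𝓛_F`, `y ∈ 𝓛_F`, `p^b y ≠ 0` and `n ≤ a + b + 1`, then
**`inv(x ∪_{m²} y) ≠ 0`**: the cup product descends to `H¹/𝓛_F × 𝓛_F` (isotropy), some `x₀` pairs
non-trivially with `p^b y ≠ 0` (local duality for `E[m²]`, Milne I Cor. 2.3), and the cyclic-group algebra
`pairing_ne_zero_of_isAddCyclic_left` concludes. [cite: McCallumLMS1991, §5 Lemma 5.3 and proof of Thm. 5.4]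
[cite: MilneADT2006, Ch. I, Cor. 2.3 and Thm. 3.2] -/
theorem inv_weilLocalCup_ne_zero_of_orders (halt : ∀ T, e T T = 1)
    (hnondeg : ∀ T, (∀ S, e S T = 1) → T = 0)
    {p n : ℕ} (hp : p.Prime) (hmn : m * m = p ^ n)
    (hT : Nat.card (AddSubgroup.torsionBy (galoisCohomology (W.localGaloisModule F) 1)
      ((m * m : ℕ) : ℤ)) = p ^ n)
    (hT₁ : Nat.card (AddSubgroup.torsionBy (galoisCohomology (W.localGaloisModule F) 1) (p : ℤ)) = p)
    {C : Type*} [AddCommGroup C]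
    (inv : galoisCohomology (GaloisRep.restrictField F (mu K (m * m))) 2 →+ C) (hinv : Injective inv)
    (hC : ∀ z : C, ((p : ℤ) ^ n) • z = 0)
    {x y : galoisCohomology (GaloisRep.restrictField F (W.torsionGaloisModule ((m * m : ℕ) : ℤ))) 1}
    {a b : ℕ} (hx : ((p : ℤ) ^ a) • x ∉ W.kummerLocalConditionAt ((m * m : ℕ) : ℤ) F)
    (hy : y ∈ W.kummerLocalConditionAt ((m * m : ℕ) : ℤ) F) (hyb : ((p : ℤ) ^ b) • y ≠ 0)
    (hn : n ≤ a + b + 1) :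
    inv (weilLocalCup W m F e hμ hadd₁ hadd₂ hgal x y) ≠ 0 := by
  haveI : NeZero (m * m) := ⟨NeZero.ne _⟩
  -- `π : H¹(F, E[m²]) → H¹(F, E)`, `𝓛 = ker π` (by definition), `T = H¹(F, E)[m²]`
  let π : galoisCohomology (GaloisRep.restrictField F (W.torsionGaloisModule ((m * m : ℕ) : ℤ))) 1 →+
      galoisCohomology (W.localGaloisModule F) 1 :=
    galoisCohomology.map (W.torsionPointsMapIntertwining ((m * m : ℕ) : ℤ) F) 1
  have h𝓛 : W.kummerLocalConditionAt ((m * m : ℕ) : ℤ) F = π.ker := rfl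
  let T := AddSubgroup.torsionBy (galoisCohomology (W.localGaloisModule F) 1) ((m * m : ℕ) : ℤ)
  -- isotropy of `𝓛` (the discharged Poonen–Rains fact over `F`)
  have hiso : ∀ ⦃x' y' : galoisCohomology (GaloisRep.restrictField F (W.torsionGaloisModule ((m * m : ℕ) : ℤ))) 1⦄,
      x' ∈ W.kummerLocalConditionAt ((m * m : ℕ) : ℤ) F → y' ∈ W.kummerLocalConditionAt ((m * m : ℕ) : ℤ) F →
        weilLocalCup W m F e hμ hadd₁ hadd₂ hgal x' y' = 0 := fun x' y' hx' hy' =>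
    weilLocalCup_eq_zero_of_mem_of_fact W m F e hμ hadd₁ hadd₂ hgal
      (kummerClass_cupProduct_kummerClass_eq_zero_holds F) halt hx' hy'
  -- right non-degeneracy of the cup product on `H¹(F, E[m²])` (local duality for `E[m²]`)
  have hright : ∀ y' : galoisCohomology (GaloisRep.restrictField F (W.torsionGaloisModule ((m * m : ℕ) : ℤ))) 1,
      (∀ x', weilLocalCup W m F e hμ hadd₁ hadd₂ hgal x' y' = 0) → y' = 0 := fun y' hy' =>
    eq_zero_of_forall_weilCupProduct_eq_zero_right W (m * m) e hμ hadd₁ hadd₂ F hgal hnondeg y'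
      fun x' => hy' x'
  -- `H¹(F, E[m²])` is killed by `m²`, so `π` lands in `T`
  have hVtors : ∀ z : galoisCohomology (GaloisRep.restrictField F (W.torsionGaloisModule ((m * m : ℕ) : ℤ))) 1,
      (m * m) • z = 0 :=
    nsmul_continuousCohomology_one_eq_zero _ (m * m)
      (fun P : geomTorsion W ((m * m : ℕ) : ℤ) => AddSubgroup.torsionBy.nsmul P)
  have hπT : ∀ z, π z ∈ T := fun z =>
    AddSubgroup.torsionBy.nsmul_iff.mpr (by rw [← map_nsmul, hVtors z, map_zero])
  -- `T` cyclic, hence `G := H¹(F, E[m²]) ⧸ 𝓛 ↪ T` cyclic of order `p^{n'}`, `n' ≤ n`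
  haveI hTcyc : IsAddCyclic T := isAddCyclic_torsionBy_localH1 W m F hp hmn hT hT₁
  let f : (_ ⧸ π.ker) →+ T := (QuotientAddGroup.kerLift π).codRestrict T fun g => by
    obtain ⟨z, rfl⟩ := QuotientAddGroup.mk_surjective g
    rw [QuotientAddGroup.kerLift_mk]
    exact hπT z
  have hf : Injective f := fun g g' h =>
    QuotientAddGroup.kerLift_injective π
      (congrArg (fun z : T => (z : galoisCohomology (W.localGaloisModule F) 1)) h)
  haveI : IsAddCyclic (_ ⧸ π.ker) := isAddCyclic_of_injective f hf
  obtain ⟨n', hn'le, hG⟩ : ∃ n' ≤ n, Nat.card (_ ⧸ π.ker) = p ^ n' :=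
    (Nat.dvd_prime_pow hp).mp (hT ▸ AddSubgroup.card_dvd_of_injective f hf)
  -- the descended pairing `B : H¹/𝓛 →+ 𝓛 →+ C`, `B (mk x') y' = inv (x' ∪ y')`
  let φ : galoisCohomology (GaloisRep.restrictField F (W.torsionGaloisModule ((m * m : ℕ) : ℤ))) 1 →+
      (W.kummerLocalConditionAt ((m * m : ℕ) : ℤ) F →+ C) :=
    AddMonoidHom.mk' (fun x' => (inv.comp (weilLocalCup W m F e hμ hadd₁ hadd₂ hgal x')).comp
      (W.kummerLocalConditionAt ((m * m : ℕ) : ℤ) F).subtype)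
      fun x' x'' => by
        ext y'
        simp only [map_add, AddMonoidHom.coe_comp, AddMonoidHom.add_apply, Function.comp_apply,
          AddSubgroup.coe_subtype]
  have hφ : ∀ x' (y' : W.kummerLocalConditionAt ((m * m : ℕ) : ℤ) F),
      φ x' y' = inv (weilLocalCup W m F e hμ hadd₁ hadd₂ hgal x' y') := fun _ _ => rfl
  have hφker : π.ker ≤ φ.ker := fun x' hx' => by
    rw [AddMonoidHom.mem_ker]
    ext y'
    rw [hφ, AddMonoidHom.zero_apply, hiso (h𝓛 ▸ hx') y'.2, map_zero]
  let B : (_ ⧸ π.ker) →+ (W.kummerLocalConditionAt ((m * m : ℕ) : ℤ) F →+ C) :=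
    QuotientAddGroup.lift π.ker φ hφker
  have hB : ∀ x' (y' : W.kummerLocalConditionAt ((m * m : ℕ) : ℤ) F),
      B (QuotientAddGroup.mk x') y' = inv (weilLocalCup W m F e hμ hadd₁ hadd₂ hgal x' y') := fun x' y' => by
    change (QuotientAddGroup.lift π.ker φ hφker (QuotientAddGroup.mk x')) y' = _
    rw [QuotientAddGroup.lift_mk]
    exact hφ x' y'
  -- the two order hypotheses, read on `H¹/𝓛` and `𝓛`
  have hg : ((p : ℤ) ^ a) • (QuotientAddGroup.mk x : _ ⧸ π.ker) ≠ 0 := by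
    intro h0
    rw [← QuotientAddGroup.mk_zsmul, QuotientAddGroup.eq_zero_iff] at h0
    exact hx (h𝓛 ▸ h0)
  have hh : ∃ g₀ : _ ⧸ π.ker,
      B g₀ (((p : ℤ) ^ b) • (⟨y, hy⟩ : W.kummerLocalConditionAt ((m * m : ℕ) : ℤ) F)) ≠ 0 := by
    by_contra hall
    push Not at hall
    apply hyb
    refine hright _ fun x' => ?_
    have h1 := hall (QuotientAddGroup.mk x')
    rw [hB] at h1
    exact hinv (h1.trans (map_zero inv).symm)
  -- McCallum's cyclic-group algebra
  have key := pairing_ne_zero_of_isAddCyclic_left B hp hn'le hG hC (g := QuotientAddGroup.mk x)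
    (h := (⟨y, hy⟩ : W.kummerLocalConditionAt ((m * m : ℕ) : ℤ) F)) hg hh hn
  rwa [hB] at key

/-- **Non-vanishing of the local term `t_F(b₁; β, β') = inv((res_F b₁ − β) ∪ β')` of the first case of the
Cassels–Tate pairing from the orders** (`β, β' ∈ 𝓛_F`; `ctLocalTerm_congr_mid` replaces `β` by `0`):
under the hypotheses of `inv_weilLocalCup_ne_zero_of_orders` with `x = res_F b₁`, `y = β'`,
**`t_F(b₁; β, β') ≠ 0`**. [cite: McCallumLMS1991, §5 Lemma 5.3 and proof of Thm. 5.4]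
[cite: MilneADT2006, Ch. I §6, proof of Prop. 6.9] -/
theorem ctLocalTerm_ne_zero_of_orders (halt : ∀ T, e T T = 1)
    (hnondeg : ∀ T, (∀ S, e S T = 1) → T = 0)
    {p n : ℕ} (hp : p.Prime) (hmn : m * m = p ^ n)
    (hT : Nat.card (AddSubgroup.torsionBy (galoisCohomology (W.localGaloisModule F) 1)
      ((m * m : ℕ) : ℤ)) = p ^ n)
    (hT₁ : Nat.card (AddSubgroup.torsionBy (galoisCohomology (W.localGaloisModule F) 1) (p : ℤ)) = p)
    (inv : galoisCohomology (GaloisRep.restrictField F (mu K (m * m))) 2 →+ ZMod (m * m)) (hinv : Injective inv)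
    (b₁ : galoisCohomology (W.torsionGaloisModule ((m * m : ℕ) : ℤ)) 1)
    {β β' : galoisCohomology (GaloisRep.restrictField F (W.torsionGaloisModule ((m * m : ℕ) : ℤ))) 1}
    (hβ : β ∈ W.kummerLocalConditionAt ((m * m : ℕ) : ℤ) F)
    (hβ' : β' ∈ W.kummerLocalConditionAt ((m * m : ℕ) : ℤ) F)
    {a b : ℕ}
    (hx : ((p : ℤ) ^ a) • galoisCohomology.res (W.torsionGaloisModule ((m * m : ℕ) : ℤ)) F 1 b₁ ∉
      W.kummerLocalConditionAt ((m * m : ℕ) : ℤ) F)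
    (hyb : ((p : ℤ) ^ b) • β' ≠ 0) (hn : n ≤ a + b + 1) :
    ctLocalTerm W m F e hμ hadd₁ hadd₂ hgal inv b₁ β β' ≠ 0 := by
  have hC : ∀ z : ZMod (m * m), ((p : ℤ) ^ n) • z = 0 := fun z => by
    rw [← Nat.cast_pow, ← hmn, natCast_zsmul, nsmul_eq_mul, ZMod.natCast_self, zero_mul]
  have hiso : ∀ ⦃x' y' : galoisCohomology (GaloisRep.restrictField F (W.torsionGaloisModule ((m * m : ℕ) : ℤ))) 1⦄,
      x' ∈ W.kummerLocalConditionAt ((m * m : ℕ) : ℤ) F → y' ∈ W.kummerLocalConditionAt ((m * m : ℕ) : ℤ) F →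
        weilLocalCup W m F e hμ hadd₁ hadd₂ hgal x' y' = 0 := fun x' y' hx' hy' =>
    weilLocalCup_eq_zero_of_mem_of_fact W m F e hμ hadd₁ hadd₂ hgal
      (kummerClass_cupProduct_kummerClass_eq_zero_holds F) halt hx' hy'
  rw [ctLocalTerm_congr_mid (invE := inv) hiso b₁ hβ (zero_mem _) hβ', ctLocalTerm, sub_zero]
  exact inv_weilLocalCup_ne_zero_of_orders W m F e hμ hadd₁ hadd₂ hgal halt hnondeg hp hmn hT hT₁ inv
    hinv hC hx hβ' hyb hn

end Generic

end Summit.BirchSwinnertonDyer.BirchSwinnertonDyer.Theorems.GenusExact.VisiblePairAtTwo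

end
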